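import Summits.CriticalPhenomena.CardyFormulaZ2.Theses.CardySelfRefinement
import Summits.CriticalPhenomena.CardyFormulaZ2.Theorems.CardySelfRefinementLagHandOffTournamentTransfer
import Literature.Probability.RandomPlanarGeometry.ChordalCurveFamilyProofs
import Literature.Probability.LatticeModels.PolylinePrefix
import Literature.Probability.Percolation.InterfaceScalingLimitProofs
import HarnessLib

/-!
# First contact of the exploration polyline with the closed half-plane east of a column
(groundwork for stub `stub_tournamentTransfer`, line `hitting-tournament`, crux `LagHandOff`,
stmt-CriticalPhenomena-10268)

Curve-level form of the lattice dictionary of `…TournamentTransfer.lean`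
(`medialExploration_first_column`): in the same situation (admissible data `E`, mesh
`δ = E.δ > 0`, start corner strictly west of the column `{re = k}`, exploration not staying in
`{re < k}`, arrival vertex `v = (k, j)` at index `τ + 2`), the exploration POLYLINE
`medialExplorationCurve E ω` (dyadic `Path.trans` clock of the tree's `polyline`,
`PolylinePrefix.lean`) lies in the open half-plane `{re < kδ}` up to the prefix time
`1 - 2^{-(τ+1)}`, sits at the midpoint `P = (kδ, (j-½)δ)` of the arrival edge at the prefix time
`1 - 2^{-(τ+2)}`, and `P` is its only point of `{kδ ≤ re}` up to then (the set `{re < kδ} ∪ {P}`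
is convex, `convex_insert_halfPlane_re_lt`, and contains the first `τ + 3` vertices).  Hence the
FIRST HITTING PARAMETER (`Curve.hitParam`, the curve surgery behind the line's `hitPoint` /
`SameTournament`) of the closed half-plane `{kδ ≤ re}` lies in `(1 - 2^{-(τ+1)}, 1 - 2^{-(τ+2)}]`
and the FIRST HITTING POINT is `P` (`medialExplorationCurve_first_column`) — the point whose left
vertex `v` and right face `v - (1,1)` carry the open / dual-open connections of the dictionary.
(Smirnov 2001 §2: the exploration as a planar curve; Camia–Newman 2007 §2: lattice paths as
polygonal curves.)

References: S. Smirnov, C. R. Acad. Sci. Paris 333 (2001), §2; F. Camia, C. M. Newman, PTRF 139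
(2007), §2.
-/

noncomputable section

open Set
open Literature.Probability.Percolation Literature.Probability.LatticeModels
open Literature.Probability.RandomPlanarGeometry

namespace Summit.CriticalPhenomena.CardyFormulaZ2.Cruxes.LagHandOff.HittingTournament

/-! ### The exploration polyline: first contact with the closed half-plane east of the column -/

section Polyline

open Summit.CriticalPhenomena.CardyFormulaZ2.Cruxes.LagHandOff.CrosscutDictionary
  (polyline_apply_prefixTime_eq_getElem)

/-- The abscissa of the midpoint of an edge drawn at mesh `δ` is `δ · edgeAbs2 / 2`. [folklore] -/
theorem medialPoint_re (δ : ℝ) (e : Sym2 (Site 2)) : (medialPoint δ e).re = δ * edgeAbs2 e / 2 := by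
  induction e using Sym2.ind with
  | h x y => simp [medialPoint_mk, Complex.add_re, meshPoint_re]; ring

/-- The ordinate of the midpoint of the pair `{u, v}` drawn at mesh `δ`. [folklore] -/
theorem medialPoint_mk_im (δ : ℝ) (u v : Site 2) :
    (medialPoint δ s(u, v)).im = δ * (u 1 + v 1) / 2 := by
  simp [medialPoint_mk, Complex.add_im, meshPoint_im]; ring

/-- An open half-plane together with ONE point of its boundary line is convex. [folklore] -/
theorem convex_insert_halfPlane_re_lt {a : ℝ} {P : ℂ} (hP : P.re = a) :
    Convex ℝ (insert P {z : ℂ | z.re < a}) := by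
  intro x hx y hy s t hs ht hst
  rcases hs.eq_or_lt with rfl | hs'
  · rw [zero_add] at hst; subst hst; simpa using hy
  rcases ht.eq_or_lt with rfl | ht'
  · rw [add_zero] at hst; subst hst; simpa using hx
  have hyre : y.re ≤ a := by
    rcases hy with rfl | hy
    · exact hP.le
    · exact le_of_lt hy
  have h3 : s * a + t * a = a := by rw [← add_mul, hst, one_mul]
  rcases hx with rfl | hx
  · rcases hy with rfl | hy
    · left
      rw [← add_smul, hst, one_smul]
    · right
      show (s • x + t • y).re < a
      have h1 : t * y.re < t * a := mul_lt_mul_of_pos_left (mem_setOf.1 hy) ht'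
      simp only [Complex.add_re, Complex.smul_re, smul_eq_mul, hP]
      linarith
  · right
    show (s • x + t • y).re < a
    have h1 : s * x.re < s * a := mul_lt_mul_of_pos_left (mem_setOf.1 hx) hs'
    have h2 : t * y.re ≤ t * a := mul_le_mul_of_nonneg_left hyre ht
    simp only [Complex.add_re, Complex.smul_re, smul_eq_mul]
    linarith

variable {E : DiscreteDobrushin} {c₀ : Site 2 × Fin 4}

/-- **First contact of the exploration polyline with the closed half-plane east of a column.**
In the situation of `medialExploration_first_column` (mesh `δ = E.δ > 0`), the exploration
polyline `medialExplorationCurve E ω` lies in the open half-plane `{re < kδ}` up to the prefix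
time `1 - 2^{-(τ+1)}`, sits at the prefix time `1 - 2^{-(τ+2)}` at the midpoint
`P = (kδ, (j - ½)δ)` of the arrival edge `{(k, j-1), (k, j)}`, and up to that time `P` is its
only point in the closed half-plane `{kδ ≤ re}`.  Consequently the FIRST HITTING parameter of
`{kδ ≤ re}` (the tree's `Curve.hitParam`) lies in `(1 - 2^{-(τ+1)}, 1 - 2^{-(τ+2)}]` and the
first hitting POINT is `P` — whose LEFT vertex `(k, j)` and RIGHT face `(k-1, j-1)` carry the open
/ dual-open connections of `medialExploration_first_column`. (Smirnov 2001, §2: the exploration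
as a planar curve; Camia–Newman 2007, §2: lattice paths as polygonal curves.)
[cite: Smirnov2001, §2] -/
theorem medialExplorationCurve_first_column (hE : E.IsZdAdmissible) (hc₀ : E.IsStartCorner c₀)
    (ω : BondConfig (Site 2)) {k : ℤ} (hwest : c₀.1 0 < k)
    (heast : ∃ e ∈ medialExploration E ω, 2 * k ≤ edgeAbs2 e) :
    ∃ (τ : ℕ) (v : Site 2), τ + 2 < (medialExploration E ω).length ∧ v 0 = k ∧
      (medialExploration E ω)[τ + 2]? = some s(v, v + cornerUnit 3) ∧
      (∀ i < τ + 2, ∀ e, (medialExploration E ω)[i]? = some e → edgeAbs2 e < 2 * k) ∧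
      cornerOrbit (E.bcBondConfig ω) c₀ (τ + 1) = (v, 2) ∧
      E.bcBondConfig ω ∩ {e | edgeAbs2 e < 2 * k} ∈ openConnIn {u : Site 2 | u 0 ≤ k} c₀.1 v ∧
      dualConfig (E.bcBondConfig ω) ∈
        openConnIn {f : Site 2 | f 0 < k ∧ E.IsInnerFace f} (cFace c₀) (faceAt v 2) ∧
      medialPoint E.δ s(v, v + cornerUnit 3) = ⟨k * E.δ, ((v 1 : ℝ) - 1 / 2) * E.δ⟩ ∧
      medialExplorationCurve E ω ⟨1 - (1 / 2) ^ (τ + 2), one_sub_half_pow_mem_unitInterval _⟩ =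
        medialPoint E.δ s(v, v + cornerUnit 3) ∧
      (∀ t : unitInterval, (t : ℝ) ≤ 1 - (1 / 2) ^ (τ + 1) →
        (medialExplorationCurve E ω t).re < k * E.δ) ∧
      (∀ t : unitInterval, (t : ℝ) ≤ 1 - (1 / 2) ^ (τ + 2) →
        k * E.δ ≤ (medialExplorationCurve E ω t).re →
          medialExplorationCurve E ω t = medialPoint E.δ s(v, v + cornerUnit 3)) ∧
      1 - (1 / 2 : ℝ) ^ (τ + 1) <
        (⟨medialExplorationCurve E ω⟩ : Curve ℂ).hitParam {z : ℂ | k * E.δ ≤ z.re} ∧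
      (⟨medialExplorationCurve E ω⟩ : Curve ℂ).hitParam {z : ℂ | k * E.δ ≤ z.re} ≤
        1 - (1 / 2 : ℝ) ^ (τ + 2) ∧
      (⟨medialExplorationCurve E ω⟩ : Curve ℂ)
          ⟨(⟨medialExplorationCurve E ω⟩ : Curve ℂ).hitParam {z : ℂ | k * E.δ ≤ z.re},
            Curve.hitParam_mem_Icc _ _⟩ = medialPoint E.δ s(v, v + cornerUnit 3) := by
  obtain ⟨τ, v, hlen, hv, hhit, hbefore, -, -, horb, -, -, hleft, hright⟩ :=
    medialExploration_first_column hE hc₀ ω hwest heast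
  have hδ : 0 < E.δ := hE.delta_pos
  set l := medialExploration E ω with hl
  set L := l.map (medialPoint E.δ) with hL
  set P := medialPoint E.δ s(v, v + cornerUnit 3) with hP
  have hcurve : medialExplorationCurve E ω = polyline L := rfl
  have hLlen : L.length = l.length := List.length_map _
  -- a nonempty polyline lies in any convex set containing its vertices (`range_polylineFrom_subset`)
  have range_polyline_subset : ∀ {C : Set ℂ}, Convex ℝ C → ∀ {l' : List ℂ}, l' ≠ [] →
      (∀ p ∈ l', p ∈ C) → Set.range (polyline l') ⊆ C := by
    intro C hC l' hl' h
    obtain ⟨a, rest, rfl⟩ := List.exists_cons_of_ne_nil hl'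
    exact range_polylineFrom_subset hC (h a (by simp)) fun p hp => h p (by simp [hp])
  -- coordinates of `P`
  have hPre : P.re = k * E.δ := by
    rw [hP, medialPoint_re, edgeAbs2_mk]
    simp only [Pi.add_apply, cornerUnit_three_apply_zero, hv]
    push_cast; ring
  have hPcoord : P = ⟨k * E.δ, ((v 1 : ℝ) - 1 / 2) * E.δ⟩ := by
    apply Complex.ext
    · rw [hPre]
    · rw [hP, medialPoint_mk_im]
      simp only [Pi.add_apply, cornerUnit_three_apply_one]
      push_cast; ring
  -- the vertices of `L`
  have hLget : ∀ i (hi : i < L.length), L[i] = medialPoint E.δ (l[i]'(by omega)) := fun i hi =>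
    List.getElem_map _
  have hLτ : L[τ + 2]'(by omega) = P := by
    rw [hLget, hP]
    congr 1
    exact (List.getElem_eq_iff (by omega)).2 hhit
  have hLlt : ∀ i (hi : i < τ + 2), (L[i]'(by omega)).re < k * E.δ := by
    intro i hi
    rw [hLget, medialPoint_re]
    have := hbefore i hi (l[i]'(by omega)) (List.getElem?_eq_getElem (by omega))
    have h' : (edgeAbs2 (l[i]'(by omega)) : ℝ) * E.δ < 2 * k * E.δ :=
      mul_lt_mul_of_pos_right (by exact_mod_cast this) hδ
    linarith
  -- the polyline at the prefix time `τ + 2`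
  have hat : medialExplorationCurve E ω ⟨1 - (1 / 2) ^ (τ + 2), one_sub_half_pow_mem_unitInterval _⟩ =
      P := by
    rw [hcurve, polyline_apply_prefixTime_eq_getElem (by omega), hLτ]
  -- before the prefix time `τ + 1`: strictly west
  have hwestCurve : ∀ t : unitInterval, (t : ℝ) ≤ 1 - (1 / 2) ^ (τ + 1) →
      (medialExplorationCurve E ω t).re < k * E.δ := by
    intro t ht
    have hmem : medialExplorationCurve E ω t ∈ polyline L '' Set.Iic
        ⟨1 - (1 / 2) ^ (τ + 1), one_sub_half_pow_mem_unitInterval _⟩ :=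
      ⟨t, ht, by rw [hcurve]⟩
    rw [polyline_image_Iic_eq_range_take (l := L) (n := τ + 1) (by omega)] at hmem
    have hsub : Set.range (polyline (L.take (τ + 1 + 1))) ⊆ {z : ℂ | z.re < k * E.δ} := by
      refine range_polyline_subset (convex_halfSpace_re_lt _) ?_ fun p hp => ?_
      · apply List.ne_nil_of_length_pos
        rw [List.length_take]
        omega
      · obtain ⟨i, hi, rfl⟩ := List.mem_iff_getElem.1 hp
        rw [List.length_take] at hi
        rw [List.getElem_take]
        exact hLlt i (by omega)
    exact hsub hmem
  -- up to the prefix time `τ + 2`: in the open half-plane or at `P`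
  have huptoCurve : ∀ t : unitInterval, (t : ℝ) ≤ 1 - (1 / 2) ^ (τ + 2) →
      medialExplorationCurve E ω t ∈ insert P {z : ℂ | z.re < k * E.δ} := by
    intro t ht
    have hmem : medialExplorationCurve E ω t ∈ polyline L '' Set.Iic
        ⟨1 - (1 / 2) ^ (τ + 2), one_sub_half_pow_mem_unitInterval _⟩ :=
      ⟨t, ht, by rw [hcurve]⟩
    rw [polyline_image_Iic_eq_range_take (l := L) (n := τ + 2) (by omega)] at hmem
    have hsub : Set.range (polyline (L.take (τ + 2 + 1))) ⊆ insert P {z : ℂ | z.re < k * E.δ} := by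
      refine range_polyline_subset (convex_insert_halfPlane_re_lt hPre) ?_ fun p hp => ?_
      · apply List.ne_nil_of_length_pos
        rw [List.length_take]
        omega
      · obtain ⟨i, hi, rfl⟩ := List.mem_iff_getElem.1 hp
        rw [List.length_take] at hi
        rw [List.getElem_take]
        rcases Nat.lt_or_ge i (τ + 2) with hi' | hi'
        · exact Or.inr (hLlt i hi')
        · have : i = τ + 2 := by omega
          subst this
          exact Or.inl hLτ
    exact hsub hmem
  have heqP : ∀ t : unitInterval, (t : ℝ) ≤ 1 - (1 / 2) ^ (τ + 2) →
      k * E.δ ≤ (medialExplorationCurve E ω t).re → medialExplorationCurve E ω t = P := by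
    intro t ht hre
    rcases huptoCurve t ht with h | h
    · exact h
    · exact absurd (mem_setOf.1 h) (not_lt.2 hre)
  -- the first hitting parameter of the closed half-plane
  set γ : Curve ℂ := ⟨medialExplorationCurve E ω⟩ with hγ
  set F : Set ℂ := {z : ℂ | k * E.δ ≤ z.re} with hF
  have hFclosed : IsClosed F := isClosed_le continuous_const Complex.continuous_re
  have hγapply : ∀ t, γ t = medialExplorationCurve E ω t := fun _ => rfl
  have hPF : γ ⟨1 - (1 / 2) ^ (τ + 2), one_sub_half_pow_mem_unitInterval _⟩ ∈ F := by
    rw [hγapply, hat]; exact hPre.ge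
  have hle : γ.hitParam F ≤ 1 - (1 / 2 : ℝ) ^ (τ + 2) := Curve.hitParam_le hPF
  have hmemF := Curve.apply_hitParam_mem hFclosed ⟨_, hPF⟩
  have hlt : 1 - (1 / 2 : ℝ) ^ (τ + 1) < γ.hitParam F := by
    by_contra h
    exact absurd (mem_setOf.1 hmemF) (not_le.2 (hwestCurve _ (not_lt.1 h)))
  refine ⟨τ, v, hlen, hv, hhit, hbefore, horb, hleft, hright, hPcoord, hat, hwestCurve, heqP,
    hlt, hle, ?_⟩
  exact heqP _ hle (mem_setOf.1 hmemF)

/-- **Registered sub-goal stub `stub_tournamentTransfer_columnFirstContact`** (tree vocabulary;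
the first-hitting part of `medialExplorationCurve_first_column`). [cite: Smirnov2001, §2] -/
theorem stub_tournamentTransfer_columnFirstContact : ∀ (E : DiscreteDobrushin) (c₀ : Site 2 × Fin 4) (ω : BondConfig (Site 2)) (k : ℤ), E.IsZdAdmissible → E.IsStartCorner c₀ → c₀.1 0 < k → (∃ e ∈ medialExploration E ω, ∀ x y : Site 2, e = s(x, y) → 2 * k ≤ x 0 + y 0) → ∃ (τ : ℕ) (v : Site 2), τ + 2 < (medialExploration E ω).length ∧ v 0 = k ∧ (medialExploration E ω)[τ + 2]? = some s(v, v + cornerUnit 3) ∧ (∀ i < τ + 2, ∀ x y : Site 2, (medialExploration E ω)[i]? = some s(x, y) → x 0 + y 0 < 2 * k) ∧ medialExplorationCurve E ω ⟨1 - (1 / 2) ^ (τ + 2), one_sub_half_pow_mem_unitInterval _⟩ = medialPoint E.δ s(v, v + cornerUnit 3) ∧ (∀ t : unitInterval, (t : ℝ) ≤ 1 - (1 / 2) ^ (τ + 1) → (medialExplorationCurve E ω t).re < k * E.δ) ∧ 1 - (1 / 2 : ℝ) ^ (τ + 1) < (⟨medialExplorationCurve E ω⟩ : Curve ℂ).hitParam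 {z : ℂ | k * E.δ ≤ z.re} ∧ (⟨medialExplorationCurve E ω⟩ : Curve ℂ).hitParam {z : ℂ | k * E.δ ≤ z.re} ≤ 1 - (1 / 2 : ℝ) ^ (τ + 2) ∧ (⟨medialExplorationCurve E ω⟩ : Curve ℂ) ⟨(⟨medialExplorationCurve E ω⟩ : Curve ℂ).hitParam {z : ℂ | k * E.δ ≤ z.re}, Curve.hitParam_mem_Icc _ _⟩ = medialPoint E.δ s(v, v + cornerUnit 3) := by
  intro E c₀ ω k hE hc₀ hwest heast
  have heast' : ∃ e ∈ medialExploration E ω, 2 * k ≤ edgeAbs2 e := by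
    obtain ⟨e, he, hke⟩ := heast
    exact ⟨e, he, (forall_eq_mk_iff e (2 * k ≤ ·)).1 hke⟩
  obtain ⟨τ, v, hlen, hv, hhit, hbefore, -, -, -, -, hat, hwestC, -, hlt, hle, hpt⟩ :=
    medialExplorationCurve_first_column hE hc₀ ω hwest heast'
  exact ⟨τ, v, hlen, hv, hhit, fun i hi x y hxy => hbefore i hi _ hxy, hat, hwestC, hlt, hle, hpt⟩

end Polyline

end Summit.CriticalPhenomena.CardyFormulaZ2.Cruxes.LagHandOff.HittingTournament

end
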